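import Summits.CriticalPhenomena.CardyFormulaZ2.Theorems.CardyBoundaryCoulombGasBoundaryDefectGaussianRStubTransportPathsPart4
import Summits.CriticalPhenomena.CardyFormulaZ2.Theorems.CardyBoundaryCoulombGasBoundaryDefectGaussianRStubTransportPathsPart13
import Literature.Probability.RandomPlanarGeometry.JordanDomainInterior
import Literature.Probability.RandomPlanarGeometry.JordanBoundaryLemmas

/-!
# Stubs `stub_dictionaryPositivity` / `stub_rainbowNonempty` of line
# `rainbow-monomials-in-excursion-kernels` — lattice regularity of the lattice approximations,
# eventually (1/2): uniform closure charts of a rectilinear Jordan domain and CHART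
# (crux `BoundaryDefectGaussianR`, stmt-CriticalPhenomena-14132; registered sub-goal
# `s16_eventually_chart`)

The two realisability stubs are EVENTUAL statements along a mesh sequence `δ_n → 0⁺` about the
lattice approximations `V_n = {v ∈ ℤ² : δ_n v ∈ closure D}` of a Jordan domain `D` whose frontier
is covered by finitely many axis-parallel segments. The D2 files consume three lattice regularity
hypotheses on `V` (textual forms in the module docstring of `…StubRealisabilityPart34`): CHART
(every boundary vertex `u ∈ V`, `u + dir k ∉ V`, has a half-plane / convex / reflex lattice chart
on the box of radius `3`), NoPinch (no unit square has exactly its two diagonal corners in `V`), and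
the king charts of `s15_cellRegion_rim` (Part 30). This file proves that CHART holds for `V = V_n`
eventually; Part 2 does NoPinch, the king charts and FLAT.

* `ec_closure_chart_at` — at every boundary point `p = γ t₀` the CLOSURE of `D` is, within some
  `r > 0` and in some frame `u = (z - p)(-i)^K`, the closed sector of `m ∈ {1, 2, 3}` quadrants
  (the wedge `tp_wedgeAt` of the transport parts read through `tp_closure_chart`, in whichever of
  its two frames carries the domain);
* `ec_uniform_closure_chart` — ONE radius `r₀ > 0` such that the closed `r₀`-disc about any
  frontier point lies in the disc of such a chart (finite subcover of the compact frontier);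
* `ec_frontier_between` — a frontier point on the segment from a point of `closure D` to a point
  off it;
* `ec_lattice_chart` — at mesh `δ ≤ r₀ / 10`, on the mesh points within `10 δ` of a frontier point,
  `V` is a half-plane `c₂ ≤ ⟨v, dir (K+1)⟩`, a quadrant `c₁ ≤ ⟨v, dir K⟩ ∧ c₂ ≤ ⟨v, dir (K+1)⟩` or
  a co-quadrant `c₂ ≤ ⟨v, dir (K+1)⟩ ∨ ⟨v, dir K⟩ ≤ c₁` (`tp_lattice_flat / convex / reflex`);
* `ec_chart_of_small` — hence CHART at mesh `δ ≤ r₀ / 10` (the box of radius `3` about a boundary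
  vertex lies within `7 δ` of a frontier point);
* `ec_eventually_chart` and the registered one-line form `s16_eventually_chart` — eventually along
  the mesh sequence, since `10 δ_n ≤ r₀` eventually (`ec_eventually_small`).
All [folklore].
-/

noncomputable section

open Set Filter Metric Topology
open Literature.Probability.RandomPlanarGeometry
open Literature.Probability.LatticeModels Literature.Probability.LatticeModels.CollarLegModel

namespace Summit.CriticalPhenomena.CardyFormulaZ2.Cruxes.BoundaryDefectGaussianR.RainbowMonomialsInExcursionKernels

/-! ### Closure charts at every boundary point -/

/-- **Closure chart at a boundary point.** For a Jordan domain whose frontier is covered by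
finitely many axis-parallel segments, near every boundary point `p = γ t₀` the closure of the
domain is, in some frame `u = (z - p)(-i)^K`, the closed sector of `m ∈ {1, 2, 3}` quadrants:
`re u ≥ 0 ∧ im u ≥ 0` (convex corner), `im u ≥ 0` (flat point), `im u ≥ 0 ∨ re u ≤ 0` (reflex
corner). (The wedge of `tp_wedgeAt` read through `tp_closure_chart`, in whichever of its two
frames carries the domain.) [folklore] -/
theorem ec_closure_chart_at (D : JordanDomain) {S : Finset (ℂ × ℂ)}
    (hS : ∀ q ∈ S, q.1.re = q.2.re ∨ q.1.im = q.2.im)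
    (hcov : frontier D.carrier ⊆ ⋃ q ∈ S, segment ℝ q.1 q.2) (t₀ : ℝ) :
    ∃ (r : ℝ) (K : Fin 4) (m : ℕ), 0 < r ∧ (m = 1 ∨ m = 2 ∨ m = 3) ∧
      ∀ z, dist z (D.boundary t₀) < r → (z ∈ closure D.carrier ↔
        (m = 1 → 0 ≤ ((z - D.boundary t₀) * (-Complex.I) ^ (K : ℕ)).re ∧
            0 ≤ ((z - D.boundary t₀) * (-Complex.I) ^ (K : ℕ)).im) ∧
          (m = 2 → 0 ≤ ((z - D.boundary t₀) * (-Complex.I) ^ (K : ℕ)).im) ∧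
          (m = 3 → 0 ≤ ((z - D.boundary t₀) * (-Complex.I) ^ (K : ℕ)).im ∨
            ((z - D.boundary t₀) * (-Complex.I) ^ (K : ℕ)).re ≤ 0)) := by
  obtain ⟨r, η, a, m, hr, -, -, ha, hm, -, -, -, -, -, -, -, hfront, hdich⟩ :=
    tp_wedgeAt D hS hcov t₀
  rcases hdich with hfirst | hsecond
  · exact ⟨r, ⟨a, ha⟩, m, hr, hm, tp_closure_chart D hm hfront hfirst⟩
  · -- the domain sits in the second frame: exponent `a + m`, `4 - m` quadrants
    have hm' : 4 - m = 1 ∨ 4 - m = 2 ∨ 4 - m = 3 := by omega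
    have h4 : (-Complex.I) ^ 4 = 1 := by rw [neg_pow, Complex.I_pow_four]; norm_num
    have hpow : ∀ n : ℕ, (-Complex.I) ^ n = (-Complex.I) ^ (n % 4) := fun n => by
      conv_lhs => rw [← Nat.div_add_mod n 4, pow_add, pow_mul, h4, one_pow, one_mul]
    have hfront' : ∀ z, dist z (D.boundary t₀) < r → (z ∈ frontier D.carrier ↔
        (((z - D.boundary t₀) * (-Complex.I) ^ (a + m)).im = 0 ∧
            0 ≤ ((z - D.boundary t₀) * (-Complex.I) ^ (a + m)).re) ∨
          (((z - D.boundary t₀) * (-Complex.I) ^ (a + m + (4 - m))).im = 0 ∧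
            0 ≤ ((z - D.boundary t₀) * (-Complex.I) ^ (a + m + (4 - m))).re)) := by
      intro z hz
      have e : a + m + (4 - m) = a + 4 := by omega
      rw [hfront z hz, e, pow_add (-Complex.I) a 4, h4, mul_one, or_comm]
    have key := tp_closure_chart D hm' hfront' hsecond
    refine ⟨r, ⟨(a + m) % 4, Nat.mod_lt _ (by norm_num)⟩, 4 - m, hr, hm', fun z hz => ?_⟩
    rw [key z hz, ← hpow]

/-- **Uniform closure charts.** For a Jordan domain with rectilinear frontier there is ONE radius
`r₀ > 0` such that the closed disc of radius `r₀` about ANY frontier point lies in the disc of a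
closure chart (`ec_closure_chart_at` at the points of a finite subcover of the compact frontier).
[folklore] -/
theorem ec_uniform_closure_chart (D : JordanDomain)
    (hrect : ∃ S : Finset (ℂ × ℂ), (∀ q ∈ S, q.1.re = q.2.re ∨ q.1.im = q.2.im) ∧
      frontier D.carrier ⊆ ⋃ q ∈ S, segment ℝ q.1 q.2) :
    ∃ r₀ > 0, ∀ ζ ∈ frontier D.carrier, ∃ (p : ℂ) (r : ℝ) (K : Fin 4) (m : ℕ),
      (m = 1 ∨ m = 2 ∨ m = 3) ∧ (∀ z, dist z ζ ≤ r₀ → dist z p < r) ∧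
      ∀ z, dist z p < r → (z ∈ closure D.carrier ↔
        (m = 1 → 0 ≤ ((z - p) * (-Complex.I) ^ (K : ℕ)).re ∧
            0 ≤ ((z - p) * (-Complex.I) ^ (K : ℕ)).im) ∧
          (m = 2 → 0 ≤ ((z - p) * (-Complex.I) ^ (K : ℕ)).im) ∧
          (m = 3 → 0 ≤ ((z - p) * (-Complex.I) ^ (K : ℕ)).im ∨
            ((z - p) * (-Complex.I) ^ (K : ℕ)).re ≤ 0)) := by
  obtain ⟨S, hS, hcov⟩ := hrect
  choose r K m hr hm hchart using fun t₀ : ℝ => ec_closure_chart_at D hS hcov t₀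
  obtain ⟨T, hT⟩ := D.isCompact_frontier.elim_finite_subcover
    (fun t : ℝ => ball (D.boundary t) (r t / 2)) (fun _ => isOpen_ball) (by
      intro ζ hζ
      rw [← D.range_boundary] at hζ
      obtain ⟨t, rfl⟩ := hζ
      exact mem_iUnion.2 ⟨t, mem_ball_self (by linarith [hr t])⟩)
  set s : Finset ℝ := insert 1 (T.image fun t => r t / 2) with hs
  have hsne : s.Nonempty := Finset.insert_nonempty _ _
  refine ⟨s.min' hsne, ?_, ?_⟩
  · refine (Finset.lt_min'_iff s hsne).2 fun y hy => ?_
    rcases Finset.mem_insert.1 hy with rfl | hy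
    · exact one_pos
    · obtain ⟨t, -, rfl⟩ := Finset.mem_image.1 hy
      linarith [hr t]
  · intro ζ hζ
    obtain ⟨t, htT, hζt⟩ := mem_iUnion₂.1 (hT hζ)
    have hmin : s.min' hsne ≤ r t / 2 :=
      Finset.min'_le s _ (Finset.mem_insert_of_mem (Finset.mem_image_of_mem _ htT))
    refine ⟨D.boundary t, r t, K t, m t, hm t, fun z hz => ?_, hchart t⟩
    have h1 : dist ζ (D.boundary t) < r t / 2 := mem_ball.1 hζt
    linarith [dist_triangle z ζ (D.boundary t)]

/-- **A frontier point between a point of the closure and a point off it**, no farther from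
either than their distance (the segment is connected and joins `D` to its complement). [folklore] -/
theorem ec_frontier_between (D : JordanDomain) {x y : ℂ} (hx : x ∈ closure D.carrier)
    (hy : y ∉ closure D.carrier) :
    ∃ ζ ∈ frontier D.carrier, dist ζ x ≤ dist x y ∧ dist ζ y ≤ dist x y := by
  have hseg : ∀ ζ ∈ segment ℝ x y, dist ζ x ≤ dist x y ∧ dist ζ y ≤ dist x y := by
    intro ζ hζ
    constructor
    · have : ζ ∈ closedBall x (dist x y) :=
        (convex_closedBall x (dist x y)).segment_subset (mem_closedBall_self dist_nonneg)
          (mem_closedBall.2 (dist_comm y x).le) hζ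
      exact mem_closedBall.1 this
    · have : ζ ∈ closedBall y (dist x y) :=
        (convex_closedBall y (dist x y)).segment_subset (mem_closedBall.2 le_rfl)
          (mem_closedBall_self dist_nonneg) hζ
      exact mem_closedBall.1 this
  rcases (closure_eq_self_union_frontier D.carrier).subset hx with hxD | hxf
  · have hyD : y ∉ D.carrier := fun h => hy (subset_closure h)
    obtain ⟨ζ, hζs, hζf⟩ := D.inter_frontier_nonempty_of_isPreconnected
      (convex_segment x y).isPreconnected ⟨x, left_mem_segment ℝ x y, hxD⟩
      ⟨y, right_mem_segment ℝ x y, hyD⟩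
    exact ⟨ζ, hζf, hseg ζ hζs⟩
  · exact ⟨x, hxf, hseg x (left_mem_segment ℝ x y)⟩

/-! ### Reading the charts on the lattice -/

/-- **Lattice charts near the frontier.** At mesh `δ` with `10 δ ≤ r₀` (`r₀` the uniform chart
radius), the lattice approximation `V = {v : δ v ∈ closure D}` is, on the mesh points within
`10 δ` of any frontier point, a half-plane `c₂ ≤ ⟨v, dir (K+1)⟩`, a quadrant
`c₁ ≤ ⟨v, dir K⟩ ∧ c₂ ≤ ⟨v, dir (K+1)⟩` or a co-quadrant `c₂ ≤ ⟨v, dir (K+1)⟩ ∨ ⟨v, dir K⟩ ≤ c₁`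
(`tp_lattice_flat / convex / reflex`). [folklore] -/
theorem ec_lattice_chart (D : JordanDomain) {δ : ℝ} (hδ : 0 < δ) {V : Finset (ℤ × ℤ)}
    (hV : ∀ v : ℤ × ℤ, v ∈ V ↔
      ((v.1 : ℂ) * ((δ : ℝ) : ℂ) + (v.2 : ℂ) * ((δ : ℝ) : ℂ) * Complex.I) ∈ closure D.carrier)
    {r₀ : ℝ} (hδr : 10 * δ ≤ r₀)
    (hunif : ∀ ζ ∈ frontier D.carrier, ∃ (p : ℂ) (r : ℝ) (K : Fin 4) (m : ℕ),
      (m = 1 ∨ m = 2 ∨ m = 3) ∧ (∀ z, dist z ζ ≤ r₀ → dist z p < r) ∧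
      ∀ z, dist z p < r → (z ∈ closure D.carrier ↔
        (m = 1 → 0 ≤ ((z - p) * (-Complex.I) ^ (K : ℕ)).re ∧
            0 ≤ ((z - p) * (-Complex.I) ^ (K : ℕ)).im) ∧
          (m = 2 → 0 ≤ ((z - p) * (-Complex.I) ^ (K : ℕ)).im) ∧
          (m = 3 → 0 ≤ ((z - p) * (-Complex.I) ^ (K : ℕ)).im ∨
            ((z - p) * (-Complex.I) ^ (K : ℕ)).re ≤ 0)))
    {ζ : ℂ} (hζ : ζ ∈ frontier D.carrier) :
    ∃ (K : Fin 4) (c₁ c₂ : ℤ),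
      (∀ v : ℤ × ℤ, dist ((v.1 : ℂ) * ((δ : ℝ) : ℂ) + (v.2 : ℂ) * ((δ : ℝ) : ℂ) * Complex.I) ζ ≤
        10 * δ → (v ∈ V ↔ c₂ ≤ v.1 * (dir (K + 1)).1 + v.2 * (dir (K + 1)).2)) ∨
      (∀ v : ℤ × ℤ, dist ((v.1 : ℂ) * ((δ : ℝ) : ℂ) + (v.2 : ℂ) * ((δ : ℝ) : ℂ) * Complex.I) ζ ≤
        10 * δ → (v ∈ V ↔ c₁ ≤ v.1 * (dir K).1 + v.2 * (dir K).2 ∧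
          c₂ ≤ v.1 * (dir (K + 1)).1 + v.2 * (dir (K + 1)).2)) ∨
      (∀ v : ℤ × ℤ, dist ((v.1 : ℂ) * ((δ : ℝ) : ℂ) + (v.2 : ℂ) * ((δ : ℝ) : ℂ) * Complex.I) ζ ≤
        10 * δ → (v ∈ V ↔ c₂ ≤ v.1 * (dir (K + 1)).1 + v.2 * (dir (K + 1)).2 ∨
          v.1 * (dir K).1 + v.2 * (dir K).2 ≤ c₁)) := by
  obtain ⟨p, r, K, m, hm, hball, hchart⟩ := hunif ζ hζ
  have hin : ∀ v : ℤ × ℤ,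
      dist ((v.1 : ℂ) * ((δ : ℝ) : ℂ) + (v.2 : ℂ) * ((δ : ℝ) : ℂ) * Complex.I) ζ ≤ 10 * δ →
      dist ((v.1 : ℂ) * ((δ : ℝ) : ℂ) + (v.2 : ℂ) * ((δ : ℝ) : ℂ) * Complex.I) p < r :=
    fun v hv => hball _ (hv.trans hδr)
  refine ⟨K, ?_⟩
  rcases hm with rfl | rfl | rfl
  · refine ⟨⌈(p * (-Complex.I) ^ (K : ℕ)).re / δ⌉, ⌈(p * (-Complex.I) ^ (K : ℕ)).im / δ⌉,
      Or.inr (Or.inl fun v hv => ?_)⟩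
    have hch : ∀ w, dist w p < r → (w ∈ closure D.carrier ↔
        0 ≤ ((w - p) * (-Complex.I) ^ (K : ℕ)).re ∧ 0 ≤ ((w - p) * (-Complex.I) ^ (K : ℕ)).im) :=
      fun w hw => by rw [hchart w hw, tp_csec_one]
    exact tp_lattice_convex hδ hV K hch v (hin v hv)
  · refine ⟨0, ⌈(p * (-Complex.I) ^ (K : ℕ)).im / δ⌉, Or.inl fun v hv => ?_⟩
    have hch : ∀ w, dist w p < r → (w ∈ closure D.carrier ↔
        0 ≤ ((w - p) * (-Complex.I) ^ (K : ℕ)).im) :=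
      fun w hw => by rw [hchart w hw, tp_csec_two]
    exact tp_lattice_flat hδ hV K hch v (hin v hv)
  · refine ⟨⌊(p * (-Complex.I) ^ (K : ℕ)).re / δ⌋, ⌈(p * (-Complex.I) ^ (K : ℕ)).im / δ⌉,
      Or.inr (Or.inr fun v hv => ?_)⟩
    have hch : ∀ w, dist w p < r → (w ∈ closure D.carrier ↔
        0 ≤ ((w - p) * (-Complex.I) ^ (K : ℕ)).im ∨ ((w - p) * (-Complex.I) ^ (K : ℕ)).re ≤ 0) :=
      fun w hw => by rw [hchart w hw, tp_csec_three]
    exact tp_lattice_reflex hδ hV K hch v (hin v hv)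

/-- Mesh points of a lattice box: if `|v.1 - u.1|, |v.2 - u.2| ≤ N` with `2 N² ≤ R'²`, the mesh
points of `v` and `u` are within `δ R'`. [folklore] -/
theorem ec_mesh_dist_box {δ : ℝ} (hδ : 0 ≤ δ) {N : ℤ} {R' : ℝ} (hR' : 0 ≤ R')
    (hNR : ((2 * N ^ 2 : ℤ) : ℝ) ≤ R' ^ 2) (v u : ℤ × ℤ) (h1 : |v.1 - u.1| ≤ N)
    (h2 : |v.2 - u.2| ≤ N) :
    dist ((v.1 : ℂ) * ((δ : ℝ) : ℂ) + (v.2 : ℂ) * ((δ : ℝ) : ℂ) * Complex.I)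
      ((u.1 : ℂ) * ((δ : ℝ) : ℂ) + (u.2 : ℂ) * ((δ : ℝ) : ℂ) * Complex.I) ≤ δ * R' := by
  refine tp_mesh_dist_le hδ hR' v u (le_trans ?_ hNR)
  have hN : 0 ≤ N := (abs_nonneg _).trans h1
  have e1 : (v.1 - u.1) ^ 2 ≤ N ^ 2 := by
    rw [← sq_abs]; exact pow_le_pow_left₀ (abs_nonneg _) h1 2
  have e2 : (v.2 - u.2) ^ 2 ≤ N ^ 2 := by
    rw [← sq_abs]; exact pow_le_pow_left₀ (abs_nonneg _) h2 2
  exact_mod_cast (by linarith : (v.1 - u.1) ^ 2 + (v.2 - u.2) ^ 2 ≤ 2 * N ^ 2)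

/-! ### CHART at small mesh -/

/-- **CHART at small mesh.** At mesh `δ` with `10 δ ≤ r₀`, every boundary vertex `u` of the lattice
approximation (`u ∈ V`, `u + dir k ∉ V`) has a half-plane / convex / reflex lattice chart on the box
of radius `3` (a frontier point lies within `2 δ` of the mesh point of `u`, and the box within
`7 δ ≤ 10 δ` of it). [folklore] -/
theorem ec_chart_of_small (D : JordanDomain) {δ : ℝ} (hδ : 0 < δ) {V : Finset (ℤ × ℤ)}
    (hV : ∀ v : ℤ × ℤ, v ∈ V ↔
      ((v.1 : ℂ) * ((δ : ℝ) : ℂ) + (v.2 : ℂ) * ((δ : ℝ) : ℂ) * Complex.I) ∈ closure D.carrier)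
    {r₀ : ℝ} (hδr : 10 * δ ≤ r₀)
    (hunif : ∀ ζ ∈ frontier D.carrier, ∃ (p : ℂ) (r : ℝ) (K : Fin 4) (m : ℕ),
      (m = 1 ∨ m = 2 ∨ m = 3) ∧ (∀ z, dist z ζ ≤ r₀ → dist z p < r) ∧
      ∀ z, dist z p < r → (z ∈ closure D.carrier ↔
        (m = 1 → 0 ≤ ((z - p) * (-Complex.I) ^ (K : ℕ)).re ∧
            0 ≤ ((z - p) * (-Complex.I) ^ (K : ℕ)).im) ∧
          (m = 2 → 0 ≤ ((z - p) * (-Complex.I) ^ (K : ℕ)).im) ∧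
          (m = 3 → 0 ≤ ((z - p) * (-Complex.I) ^ (K : ℕ)).im ∨
            ((z - p) * (-Complex.I) ^ (K : ℕ)).re ≤ 0))) :
    ∀ u ∈ V, ∀ k : Fin 4, u + dir k ∉ V → ∃ (K : Fin 4) (c₁ c₂ : ℤ),
      (∀ v : ℤ × ℤ, |v.1 - u.1| ≤ 3 → |v.2 - u.2| ≤ 3 →
        (v ∈ V ↔ c₂ ≤ v.1 * (dir (K + 1)).1 + v.2 * (dir (K + 1)).2)) ∨
      (∀ v : ℤ × ℤ, |v.1 - u.1| ≤ 3 → |v.2 - u.2| ≤ 3 →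
        (v ∈ V ↔ c₁ ≤ v.1 * (dir K).1 + v.2 * (dir K).2 ∧
          c₂ ≤ v.1 * (dir (K + 1)).1 + v.2 * (dir (K + 1)).2)) ∨
      (∀ v : ℤ × ℤ, |v.1 - u.1| ≤ 3 → |v.2 - u.2| ≤ 3 →
        (v ∈ V ↔ c₂ ≤ v.1 * (dir (K + 1)).1 + v.2 * (dir (K + 1)).2 ∨
          v.1 * (dir K).1 + v.2 * (dir K).2 ≤ c₁)) := by
  intro u hu k hk
  obtain ⟨ζ, hζ, hζu, -⟩ := ec_frontier_between D ((hV u).1 hu) (fun h => hk ((hV _).2 h))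
  have h1 : dist ((u.1 : ℂ) * ((δ : ℝ) : ℂ) + (u.2 : ℂ) * ((δ : ℝ) : ℂ) * Complex.I)
      (((u + dir k).1 : ℂ) * ((δ : ℝ) : ℂ) + ((u + dir k).2 : ℂ) * ((δ : ℝ) : ℂ) * Complex.I) ≤
      δ * 2 := by
    refine ec_mesh_dist_box hδ.le (N := 1) (by norm_num) (by norm_num) u (u + dir k) ?_ ?_
    · fin_cases k <;> simp [tp_dir_val]
    · fin_cases k <;> simp [tp_dir_val]
  have hbox : ∀ v : ℤ × ℤ, |v.1 - u.1| ≤ 3 → |v.2 - u.2| ≤ 3 →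
      dist ((v.1 : ℂ) * ((δ : ℝ) : ℂ) + (v.2 : ℂ) * ((δ : ℝ) : ℂ) * Complex.I) ζ ≤ 10 * δ := by
    intro v hv1 hv2
    have h2 := ec_mesh_dist_box hδ.le (N := 3) (R' := 5) (by norm_num) (by norm_num) v u hv1 hv2
    have h3 := dist_triangle ((v.1 : ℂ) * ((δ : ℝ) : ℂ) + (v.2 : ℂ) * ((δ : ℝ) : ℂ) * Complex.I)
      ((u.1 : ℂ) * ((δ : ℝ) : ℂ) + (u.2 : ℂ) * ((δ : ℝ) : ℂ) * Complex.I) ζ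
    have h4 := dist_comm ((u.1 : ℂ) * ((δ : ℝ) : ℂ) + (u.2 : ℂ) * ((δ : ℝ) : ℂ) * Complex.I) ζ
    linarith
  obtain ⟨K, c₁, c₂, h⟩ := ec_lattice_chart D hδ hV hδr hunif hζ
  refine ⟨K, c₁, c₂, ?_⟩
  rcases h with h | h | h
  · exact Or.inl fun v hv1 hv2 => h v (hbox v hv1 hv2)
  · exact Or.inr (Or.inl fun v hv1 hv2 => h v (hbox v hv1 hv2))
  · exact Or.inr (Or.inr fun v hv1 hv2 => h v (hbox v hv1 hv2))

/-! ### Eventually along a mesh sequence -/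

/-- **A mesh sequence is eventually below the uniform chart scale**: `10 δ_n ≤ r₀` eventually,
together with the uniform closure charts of radius `r₀`. [folklore] -/
theorem ec_eventually_small (D : JordanDomain)
    (hrect : ∃ S : Finset (ℂ × ℂ), (∀ q ∈ S, q.1.re = q.2.re ∨ q.1.im = q.2.im) ∧
      frontier D.carrier ⊆ ⋃ q ∈ S, segment ℝ q.1 q.2)
    (δ : ℕ → ℝ) (hδ0 : Tendsto δ atTop (𝓝 0)) :
    ∃ r₀ : ℝ, (∀ ζ ∈ frontier D.carrier, ∃ (p : ℂ) (r : ℝ) (K : Fin 4) (m : ℕ),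
      (m = 1 ∨ m = 2 ∨ m = 3) ∧ (∀ z, dist z ζ ≤ r₀ → dist z p < r) ∧
      ∀ z, dist z p < r → (z ∈ closure D.carrier ↔
        (m = 1 → 0 ≤ ((z - p) * (-Complex.I) ^ (K : ℕ)).re ∧
            0 ≤ ((z - p) * (-Complex.I) ^ (K : ℕ)).im) ∧
          (m = 2 → 0 ≤ ((z - p) * (-Complex.I) ^ (K : ℕ)).im) ∧
          (m = 3 → 0 ≤ ((z - p) * (-Complex.I) ^ (K : ℕ)).im ∨
            ((z - p) * (-Complex.I) ^ (K : ℕ)).re ≤ 0))) ∧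
      ∀ᶠ n in atTop, 10 * δ n ≤ r₀ := by
  obtain ⟨r₀, hr₀, hunif⟩ := ec_uniform_closure_chart D hrect
  refine ⟨r₀, hunif, ?_⟩
  have hev : ∀ᶠ n in atTop, δ n < r₀ / 10 := hδ0 (Iio_mem_nhds (by positivity))
  filter_upwards [hev] with n hn
  linarith

/-- **CHART, eventually.** Along a mesh sequence `δ_n → 0⁺`, the lattice approximations
`V_n = {v : δ_n v ∈ closure D}` of a rectilinear Jordan domain eventually satisfy the hypothesis
CHART of the open-edge level theorem (`s13_openEdgeLevels`): every boundary vertex has a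
half-plane / convex / reflex lattice chart on the box of radius `3`. [folklore] -/
theorem ec_eventually_chart (D : JordanDomain)
    (hrect : ∃ S : Finset (ℂ × ℂ), (∀ q ∈ S, q.1.re = q.2.re ∨ q.1.im = q.2.im) ∧
      frontier D.carrier ⊆ ⋃ q ∈ S, segment ℝ q.1 q.2)
    (δ : ℕ → ℝ) (hδ : ∀ n, 0 < δ n) (hδ0 : Tendsto δ atTop (𝓝 0)) (V : ℕ → Finset (ℤ × ℤ))
    (hV : ∀ n, ∀ v : ℤ × ℤ, v ∈ V n ↔
      ((v.1 : ℂ) * ((δ n : ℝ) : ℂ) + (v.2 : ℂ) * ((δ n : ℝ) : ℂ) * Complex.I) ∈ closure D.carrier) :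
    ∀ᶠ n in atTop, ∀ u ∈ V n, ∀ k : Fin 4, u + dir k ∉ V n → ∃ (K : Fin 4) (c₁ c₂ : ℤ),
      (∀ v : ℤ × ℤ, |v.1 - u.1| ≤ 3 → |v.2 - u.2| ≤ 3 →
        (v ∈ V n ↔ c₂ ≤ v.1 * (dir (K + 1)).1 + v.2 * (dir (K + 1)).2)) ∨
      (∀ v : ℤ × ℤ, |v.1 - u.1| ≤ 3 → |v.2 - u.2| ≤ 3 →
        (v ∈ V n ↔ c₁ ≤ v.1 * (dir K).1 + v.2 * (dir K).2 ∧
          c₂ ≤ v.1 * (dir (K + 1)).1 + v.2 * (dir (K + 1)).2)) ∨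
      (∀ v : ℤ × ℤ, |v.1 - u.1| ≤ 3 → |v.2 - u.2| ≤ 3 →
        (v ∈ V n ↔ c₂ ≤ v.1 * (dir (K + 1)).1 + v.2 * (dir (K + 1)).2 ∨
          v.1 * (dir K).1 + v.2 * (dir K).2 ≤ c₁)) := by
  obtain ⟨r₀, hunif, hev⟩ := ec_eventually_small D hrect δ hδ0
  filter_upwards [hev] with n hn
  exact ec_chart_of_small D (hδ n) (hV n) hn hunif

/-! ### Registered sub-goals -/

/-- **Registered sub-goal `s16_eventually_chart`** of `stub_dictionaryPositivity` /
`stub_rainbowNonempty` (stmt-CriticalPhenomena-14132): along a mesh sequence the lattice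
approximations of a rectilinear Jordan domain eventually satisfy CHART (one-line form of
`ec_eventually_chart`). [folklore] -/
theorem s16_eventually_chart : ∀ (D : Literature.Probability.RandomPlanarGeometry.JordanDomain), (∃ S : Finset (ℂ × ℂ), (∀ q ∈ S, q.1.re = q.2.re ∨ q.1.im = q.2.im) ∧ frontier D.carrier ⊆ ⋃ q ∈ S, segment ℝ q.1 q.2) → ∀ (δ : ℕ → ℝ), (∀ n, 0 < δ n) → Filter.Tendsto δ Filter.atTop (nhds 0) → ∀ (V : ℕ → Finset (ℤ × ℤ)), (∀ n, ∀ v : ℤ × ℤ, v ∈ V n ↔ (((v).1 : ℂ) * ((δ n : ℝ) : ℂ) + ((v).2 : ℂ) * ((δ n : ℝ) : ℂ) * Complex.I) ∈ closure D.carrier) → ∀ᶠ n in Filter.atTop, ∀ u ∈ V n, ∀ k : Fin 4, u + Literature.Probability.LatticeModels.CollarLegModel.dir k ∉ V n → ∃ (K : Fin 4) (c₁ c₂ : ℤ), (∀ v : ℤ × ℤ, |v.1 - u.1| ≤ 3 → |v.2 - u.2| ≤ 3 → (v ∈ V n ↔ c₂ ≤ v.1 * (Literature.Probability.LatticeModels.CollarLegModel.dir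 (K + 1)).1 + v.2 * (Literature.Probability.LatticeModels.CollarLegModel.dir (K + 1)).2)) ∨ (∀ v : ℤ × ℤ, |v.1 - u.1| ≤ 3 → |v.2 - u.2| ≤ 3 → (v ∈ V n ↔ c₁ ≤ v.1 * (Literature.Probability.LatticeModels.CollarLegModel.dir K).1 + v.2 * (Literature.Probability.LatticeModels.CollarLegModel.dir K).2 ∧ c₂ ≤ v.1 * (Literature.Probability.LatticeModels.CollarLegModel.dir (K + 1)).1 + v.2 * (Literature.Probability.LatticeModels.CollarLegModel.dir (K + 1)).2)) ∨ (∀ v : ℤ × ℤ, |v.1 - u.1| ≤ 3 → |v.2 - u.2| ≤ 3 → (v ∈ V n ↔ c₂ ≤ v.1 * (Literature.Probability.LatticeModels.CollarLegModel.dir (K + 1)).1 + v.2 * (Literature.Probability.LatticeModels.CollarLegModel.dir (K + 1)).2 ∨ v.1 * (Literature.Probability.LatticeModels.CollarLegModel.dir K).1 + v.2 * (Literature.Probability.LatticeModels.CollarLegModel.dir K).2 ≤ c₁)) :=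
  fun D hD δ hδ hδ0 V hV => ec_eventually_chart D hD δ hδ hδ0 V hV

end Summit.CriticalPhenomena.CardyFormulaZ2.Cruxes.BoundaryDefectGaussianR.RainbowMonomialsInExcursionKernels

end
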